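import Literature.Analysis.Calculus.IteratedFDerivBlockPeeling       -- (this seat) (E4): `contDiffOn_and_forall_bound_nestedBlockReaders` (block peeling, S-form, index sequences)
import HarnessLib

/-!
# (E5) TWO-STAGE MIXED PEELING — two block types peeled in succession (faces, then scalar places) by ★ (E4) in S-form
# (Varadarajan 1977 I §1.12; Bouaziz 1994 §3.1 (I₁)–(I₂); Hörmander ALPDO I §1.1, §2.1)

Topic `Analysis/Calculus`; namespace `Literature.Analysis.Calculus` (generic).  THEOREMS ONLY (no `def`, no instance, no notation, no axiom, no named fact, no `sorry`).  Cell
`pub/hodgecm-mathlib`, crux H413 (`stmt-HodgeConjecture-24833`), F0∕P3c line LH3 (leaf `F0_P3c_StubN9Direct` v5.1), organ **O-L1d′ `stub_N9hcCentralMixedJetBounds`** (LH3-plan (g4) RULING #19: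
(hCm-ASM) → F0P3a-p08 (g23)); brick (E5).  Stage 1 peels the `m₁` blocks of type `(M₁, V₁)` (readers `Φ₁ : ι₁ → …`, slots `e₁`, tower `H₁`) with the `m₂` blocks of type `(M₂, V₂)` as SMOOTH
PARAMETERS; stage 2 peels those (readers `Φ₂ : ι₂ → …`, slots `e₂`, tower `H₂`) over the open-but-not-compact parameter set `Q ×ˢ T₁^{m₁}` — both by ★ (E4) S-form.  For the MIXED organ:
`(M₁, V₁) = (M₂(ℂ), ℝ)` (faces: ★ (X3-rk1) readers, ★ (J) p851247 tower) and `(M₂, V₂) = (M₃(ℂ), Fin 3 → ℝ)` (scalar compact places: ★ p851275 readers, ★ `ArchCentralTowerFubini` tower).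
HONEST LABEL: generic calculus; count-neutral; HC_CM is proved only modulo the 7 printed citations (2 remaining: hLiu418 = stmt-HodgeConjecture-24832, h413 = stmt-HodgeConjecture-24833)
until rung 0 closes.

## References
* [Varadarajan1977] V. S. Varadarajan, *Harmonic Analysis on Real Reductive Groups*, LNM 576 (1977), Part I §1.12, §3.
* [Bouaziz1994IntegralesOrbitales] A. Bouaziz, *Intégrales orbitales sur les groupes de Lie réductifs*, Ann. Sci. ÉNS 27 (1994), §3.1 (I₁)–(I₂) p. 579, §3.2 p. 580.
* [HormanderALPDO1] L. Hörmander, *The Analysis of Linear Partial Differential Operators I*, 2nd ed. (1990), §1.1 Thm. 1.1.8, (1.1.9); §2.1.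
-/

set_option autoImplicit false

noncomputable section

open Set Filter Topology Function
open scoped ContDiff ENNReal

namespace Literature.Analysis.Calculus

open Literature.NumberTheory.Rogawski1990

section TwoStage

variable {E : Type} [NormedAddCommGroup E] [NormedSpace ℝ E]

/-- **(E5) TWO-STAGE MIXED PEELING** — two block types peeled in succession: stage 1 peels the `m₁` blocks of type `(M₁, V₁)` (reader `Φ₁`, tower `H₁`) with the `m₂` blocks of
type `(M₂, V₂)` as SMOOTH PARAMETERS, stage 2 peels those (reader `Φ₂`, tower `H₂`) over the open-but-not-compact parameter set `Q ×ˢ T₁^{m₁}` — both stages by the S-form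
`contDiffOn_and_forall_bound_nestedBlockReader`.  For the MIXED organ: `(M₁, V₁) = (M₂(ℂ), ℝ)` (faces, ★ (X3-rk1) readers) and `(M₂, V₂) = (M₃(ℂ), Fin 3 → ℝ)` (scalar compact places,
★ (B3-ENGINE) readers).  Conclusion: the two-stage nested function is smooth on `(Q ×ˢ T₁^{m₁}) ×ˢ T₂^{m₂}` with every jet bounded on `((S ∩ Q) ×ˢ (T₁ ∩ T₀₁)^{m₁}) ×ˢ (T₂ ∩ T₀₂)^{m₂}`.
[cite: Varadarajan1977, Part I §1.12] [cite: Bouaziz1994IntegralesOrbitales, §3.1 (I₁)–(I₂) p. 579; §3.2 p. 580] [cite: HormanderALPDO1, §1.1 Thm. 1.1.8; §2.1] -/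
theorem contDiffOn_and_forall_bound_twoStage_nestedBlockReaders
    {M₁ V₁ M₂ V₂ : Type} [NormedAddCommGroup M₁] [NormedSpace ℝ M₁] [FiniteDimensional ℝ M₁] [NormedAddCommGroup V₁] [NormedSpace ℝ V₁] [FiniteDimensional ℝ V₁]
    [NormedAddCommGroup M₂] [NormedSpace ℝ M₂] [FiniteDimensional ℝ M₂] [NormedAddCommGroup V₂] [NormedSpace ℝ V₂] [FiniteDimensional ℝ V₂]
    -- stage 1 reader
    {ι₁ : Type*} (Φ₁ : ι₁ → (M₁ → E) → V₁ → E) {T₁ : Set V₁} (hT₁ : IsOpen T₁) (T₀₁ : Set V₁)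
    (hunif₁ : ∀ (i : ι₁) (J : Type) (Gf : M₁ → lp (fun _ : J => E) ⊤), ContDiff ℝ ∞ Gf → HasCompactSupport Gf → ∀ n : ℕ,
      ∃ B : ℝ, ∀ θ ∈ T₁ ∩ T₀₁, ∀ ℓ : lp (fun _ : J => E) ⊤ →L[ℝ] E, ‖iteratedFDeriv ℝ n (Φ₁ i (fun X => ℓ (Gf X))) θ‖ ≤ ‖ℓ‖ * B)
    (hread₁ : ∀ (i : ι₁) (P' : Type) [NormedAddCommGroup P'] [NormedSpace ℝ P'] [FiniteDimensional ℝ P'] (O : Set P'), IsOpen O → ∀ g : P' → M₁ → E,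
      ContDiffOn ℝ ∞ (uncurry g) (O ×ˢ univ) → (∃ C : Set M₁, IsCompact C ∧ ∀ q ∈ O, ∀ X, X ∉ C → g q X = 0) →
        ContDiffOn ℝ ∞ (fun z : P' × V₁ => Φ₁ i (g z.1) z.2) (O ×ˢ T₁) ∧
        ∀ (v : P') (z : P' × V₁), z ∈ O ×ˢ T₁ → fderiv ℝ (fun z : P' × V₁ => Φ₁ i (g z.1) z.2) z (v, 0) = Φ₁ i (fun X => fderiv ℝ (fun q' => g q' X) z.1 v) z.2)
    (H₁ : (ℕ → ι₁) → ∀ (m : ℕ) (P' : Type), (P' × (Fin m → M₁) → E) → (P' × (Fin m → V₁) → E))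
    (hH0₁ : ∀ (e : ℕ → ι₁) (P' : Type) (f : P' × (Fin 0 → M₁) → E) (q : P') (θ : Fin 0 → V₁), H₁ e 0 P' f (q, θ) = f (q, fun k => k.elim0))
    (hHsucc₁ : ∀ (e : ℕ → ι₁) (m : ℕ) (P' : Type) [NormedAddCommGroup P'] [NormedSpace ℝ P'] (Q : Set P'), IsOpen Q →
      ∀ (f : P' × (Fin (m + 1) → M₁) → E),
      ContDiffOn ℝ ∞ f (Q ×ˢ univ) → (∃ C : Set M₁, IsCompact C ∧ ∀ (q : P') (X : Fin (m + 1) → M₁), (∃ k, X k ∉ C) → f (q, X) = 0) →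
      ∀ q ∈ Q, ∀ θ : Fin (m + 1) → V₁, (∀ k, θ k ∈ T₁) →
        H₁ e (m + 1) P' f (q, θ) = Φ₁ (e 0) (fun X₀ => H₁ (fun k => e (k + 1)) m (P' × M₁) (fun p => f (p.1.1, Fin.cons p.1.2 p.2)) ((q, X₀), Fin.tail θ)) (θ 0))
    (hHzero₁ : ∀ (e : ℕ → ι₁) (m : ℕ) (P' : Type) (f : P' × (Fin m → M₁) → E) (q : P') (θ : Fin m → V₁),
      (∀ X, f (q, X) = 0) → H₁ e m P' f (q, θ) = 0) (e₁ : ℕ → ι₁)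
    -- stage 2 reader
    {ι₂ : Type*} (Φ₂ : ι₂ → (M₂ → E) → V₂ → E) {T₂ : Set V₂} (hT₂ : IsOpen T₂) (T₀₂ : Set V₂)
    (hunif₂ : ∀ (i : ι₂) (J : Type) (Gf : M₂ → lp (fun _ : J => E) ⊤), ContDiff ℝ ∞ Gf → HasCompactSupport Gf → ∀ n : ℕ,
      ∃ B : ℝ, ∀ θ ∈ T₂ ∩ T₀₂, ∀ ℓ : lp (fun _ : J => E) ⊤ →L[ℝ] E, ‖iteratedFDeriv ℝ n (Φ₂ i (fun X => ℓ (Gf X))) θ‖ ≤ ‖ℓ‖ * B)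
    (hread₂ : ∀ (i : ι₂) (P' : Type) [NormedAddCommGroup P'] [NormedSpace ℝ P'] [FiniteDimensional ℝ P'] (O : Set P'), IsOpen O → ∀ g : P' → M₂ → E,
      ContDiffOn ℝ ∞ (uncurry g) (O ×ˢ univ) → (∃ C : Set M₂, IsCompact C ∧ ∀ q ∈ O, ∀ X, X ∉ C → g q X = 0) →
        ContDiffOn ℝ ∞ (fun z : P' × V₂ => Φ₂ i (g z.1) z.2) (O ×ˢ T₂) ∧
        ∀ (v : P') (z : P' × V₂), z ∈ O ×ˢ T₂ → fderiv ℝ (fun z : P' × V₂ => Φ₂ i (g z.1) z.2) z (v, 0) = Φ₂ i (fun X => fderiv ℝ (fun q' => g q' X) z.1 v) z.2)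
    (H₂ : (ℕ → ι₂) → ∀ (m : ℕ) (P' : Type), (P' × (Fin m → M₂) → E) → (P' × (Fin m → V₂) → E))
    (hH0₂ : ∀ (e : ℕ → ι₂) (P' : Type) (f : P' × (Fin 0 → M₂) → E) (q : P') (θ : Fin 0 → V₂), H₂ e 0 P' f (q, θ) = f (q, fun k => k.elim0))
    (hHsucc₂ : ∀ (e : ℕ → ι₂) (m : ℕ) (P' : Type) [NormedAddCommGroup P'] [NormedSpace ℝ P'] (Q : Set P'), IsOpen Q →
      ∀ (f : P' × (Fin (m + 1) → M₂) → E),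
      ContDiffOn ℝ ∞ f (Q ×ˢ univ) → (∃ C : Set M₂, IsCompact C ∧ ∀ (q : P') (X : Fin (m + 1) → M₂), (∃ k, X k ∉ C) → f (q, X) = 0) →
      ∀ q ∈ Q, ∀ θ : Fin (m + 1) → V₂, (∀ k, θ k ∈ T₂) →
        H₂ e (m + 1) P' f (q, θ) = Φ₂ (e 0) (fun X₀ => H₂ (fun k => e (k + 1)) m (P' × M₂) (fun p => f (p.1.1, Fin.cons p.1.2 p.2)) ((q, X₀), Fin.tail θ)) (θ 0))
    (hHzero₂ : ∀ (e : ℕ → ι₂) (m : ℕ) (P' : Type) (f : P' × (Fin m → M₂) → E) (q : P') (θ : Fin m → V₂),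
      (∀ X, f (q, X) = 0) → H₂ e m P' f (q, θ) = 0) (e₂ : ℕ → ι₂)
    -- the two-type base family
    (m₁ m₂ : ℕ) (P : Type) [NormedAddCommGroup P] [NormedSpace ℝ P] [FiniteDimensional ℝ P] {Q : Set P} (hQ : IsOpen Q)
    (f : P × ((Fin m₁ → M₁) × (Fin m₂ → M₂)) → E) (hf : ContDiffOn ℝ ∞ f (Q ×ˢ univ))
    {C₁ : Set M₁} (hC₁ : IsCompact C₁) (hfC₁ : ∀ (q : P) (X : (Fin m₁ → M₁) × (Fin m₂ → M₂)), (∃ k, X.1 k ∉ C₁) → f (q, X) = 0)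
    {C₂ : Set M₂} (hC₂ : IsCompact C₂) (hfC₂ : ∀ (q : P) (X : (Fin m₁ → M₁) × (Fin m₂ → M₂)), (∃ k, X.2 k ∉ C₂) → f (q, X) = 0)
    (S : Set P) (hfbd : ∀ n : ℕ, ∃ B : ℝ, ∀ z ∈ (S ∩ Q) ×ˢ (univ : Set ((Fin m₁ → M₁) × (Fin m₂ → M₂))), ‖iteratedFDeriv ℝ n f z‖ ≤ B) :
    ContDiffOn ℝ ∞
        (H₂ e₂ m₂ (P × (Fin m₁ → V₁)) (fun z : (P × (Fin m₁ → V₁)) × (Fin m₂ → M₂) =>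
          H₁ e₁ m₁ (P × (Fin m₂ → M₂)) (fun y : (P × (Fin m₂ → M₂)) × (Fin m₁ → M₁) => f (y.1.1, (y.2, y.1.2))) ((z.1.1, z.2), z.1.2)))
        ((Q ×ˢ Set.pi univ fun _ => T₁) ×ˢ Set.pi univ fun _ => T₂) ∧
      ∀ n : ℕ, ∃ B : ℝ, ∀ z ∈ ((S ∩ Q) ×ˢ Set.pi univ (fun _ => T₁ ∩ T₀₁)) ×ˢ Set.pi univ (fun _ => T₂ ∩ T₀₂),
        ‖iteratedFDeriv ℝ n (H₂ e₂ m₂ (P × (Fin m₁ → V₁)) (fun z : (P × (Fin m₁ → V₁)) × (Fin m₂ → M₂) =>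
          H₁ e₁ m₁ (P × (Fin m₂ → M₂)) (fun y : (P × (Fin m₂ → M₂)) × (Fin m₁ → M₁) => f (y.1.1, (y.2, y.1.2))) ((z.1.1, z.2), z.1.2))) z‖ ≤ B := by
  -- STAGE 1: parameters `P₁ = P × (Fin m₂ → M₂)`, base `f₁ = f ∘ κ₁`
  set κ₁ : (P × (Fin m₂ → M₂)) × (Fin m₁ → M₁) →L[ℝ] P × ((Fin m₁ → M₁) × (Fin m₂ → M₂)) :=
    ((ContinuousLinearMap.fst ℝ P (Fin m₂ → M₂)).comp (ContinuousLinearMap.fst ℝ (P × (Fin m₂ → M₂)) (Fin m₁ → M₁))).prod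
      ((ContinuousLinearMap.snd ℝ (P × (Fin m₂ → M₂)) (Fin m₁ → M₁)).prod
        ((ContinuousLinearMap.snd ℝ P (Fin m₂ → M₂)).comp (ContinuousLinearMap.fst ℝ (P × (Fin m₂ → M₂)) (Fin m₁ → M₁)))) with hκ₁def
  have hκ₁ : ∀ y : (P × (Fin m₂ → M₂)) × (Fin m₁ → M₁), κ₁ y = (y.1.1, (y.2, y.1.2)) := fun y => rfl
  set f₁ : (P × (Fin m₂ → M₂)) × (Fin m₁ → M₁) → E := fun y => f (y.1.1, (y.2, y.1.2)) with hf₁def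
  have hf₁κ : f₁ = f ∘ κ₁ := funext fun y => by rw [comp_apply, hκ₁]
  have hQ₁ : IsOpen (Q ×ˢ (univ : Set (Fin m₂ → M₂))) := hQ.prod isOpen_univ
  have hQu : IsOpen (Q ×ˢ (univ : Set ((Fin m₁ → M₁) × (Fin m₂ → M₂)))) := hQ.prod isOpen_univ
  have hκ₁maps : MapsTo κ₁ ((Q ×ˢ (univ : Set (Fin m₂ → M₂))) ×ˢ univ) (Q ×ˢ univ) := fun y hy => by rw [hκ₁]; exact ⟨hy.1.1, mem_univ _⟩
  have hf₁s : ContDiffOn ℝ ∞ f₁ ((Q ×ˢ (univ : Set (Fin m₂ → M₂))) ×ˢ univ) := by rw [hf₁κ]; exact hf.comp κ₁.contDiff.contDiffOn hκ₁maps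
  have hf₁C : ∀ (p : P × (Fin m₂ → M₂)) (X : Fin m₁ → M₁), (∃ k, X k ∉ C₁) → f₁ (p, X) = 0 := fun p X hX => hfC₁ p.1 (X, p.2) hX
  have hf₁bd : ∀ n : ℕ, ∃ B : ℝ, ∀ z ∈ ((S ×ˢ (univ : Set (Fin m₂ → M₂))) ∩ (Q ×ˢ univ)) ×ˢ (univ : Set (Fin m₁ → M₁)), ‖iteratedFDeriv ℝ n f₁ z‖ ≤ B := fun n => by
    obtain ⟨B, hB⟩ := hfbd n
    refine ⟨‖κ₁‖ ^ n * max B 0, fun z hz => ?_⟩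
    have hzκ : κ₁ z ∈ Q ×ˢ (univ : Set ((Fin m₁ → M₁) × (Fin m₂ → M₂))) := hκ₁maps ⟨hz.1.2, mem_univ _⟩
    rw [hf₁κ]
    refine (norm_iteratedFDeriv_comp_clm_le_of_isOpen κ₁ hQu (hf.of_le (mod_cast le_top)) (n := n) hzκ).trans ?_
    refine mul_le_mul_of_nonneg_left ((hB _ ?_).trans (le_max_left _ _)) (pow_nonneg (norm_nonneg _) _)
    rw [hκ₁]; exact ⟨⟨hz.1.1.1, hz.1.2.1⟩, mem_univ _⟩
  obtain ⟨hG₁s, hG₁bd⟩ := contDiffOn_and_forall_bound_nestedBlockReaders Φ₁ hT₁ T₀₁ hunif₁ hread₁ H₁ hH0₁ hHsucc₁ hHzero₁ m₁ e₁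
    (P × (Fin m₂ → M₂)) (Q ×ˢ univ) hQ₁ f₁ hf₁s C₁ hC₁ hf₁C (S ×ˢ univ) hf₁bd
  -- STAGE 2: parameters `P₂ = P × (Fin m₁ → V₁)`, base `f₂ = G₁ ∘ τ`
  set τ : (P × (Fin m₁ → V₁)) × (Fin m₂ → M₂) →L[ℝ] (P × (Fin m₂ → M₂)) × (Fin m₁ → V₁) :=
    (((ContinuousLinearMap.fst ℝ P (Fin m₁ → V₁)).comp (ContinuousLinearMap.fst ℝ (P × (Fin m₁ → V₁)) (Fin m₂ → M₂))).prod
        (ContinuousLinearMap.snd ℝ (P × (Fin m₁ → V₁)) (Fin m₂ → M₂))).prod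
      ((ContinuousLinearMap.snd ℝ P (Fin m₁ → V₁)).comp (ContinuousLinearMap.fst ℝ (P × (Fin m₁ → V₁)) (Fin m₂ → M₂))) with hτdef
  have hτ : ∀ z : (P × (Fin m₁ → V₁)) × (Fin m₂ → M₂), τ z = ((z.1.1, z.2), z.1.2) := fun z => rfl
  set f₂ : (P × (Fin m₁ → V₁)) × (Fin m₂ → M₂) → E := fun z => H₁ e₁ m₁ (P × (Fin m₂ → M₂)) f₁ ((z.1.1, z.2), z.1.2) with hf₂def
  have hf₂τ : f₂ = (H₁ e₁ m₁ (P × (Fin m₂ → M₂)) f₁) ∘ τ := funext fun z => by rw [comp_apply, hτ]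
  have hQ₂ : IsOpen (Q ×ˢ Set.pi univ fun _ : Fin m₁ => T₁) := hQ.prod (isOpen_set_pi finite_univ fun _ _ => hT₁)
  have hO₁ : IsOpen ((Q ×ˢ (univ : Set (Fin m₂ → M₂))) ×ˢ Set.pi univ fun _ : Fin m₁ => T₁) := hQ₁.prod (isOpen_set_pi finite_univ fun _ _ => hT₁)
  have hτmaps : MapsTo τ ((Q ×ˢ Set.pi univ fun _ : Fin m₁ => T₁) ×ˢ (univ : Set (Fin m₂ → M₂))) ((Q ×ˢ (univ : Set (Fin m₂ → M₂))) ×ˢ Set.pi univ fun _ : Fin m₁ => T₁) :=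
    fun z hz => by rw [hτ]; exact ⟨⟨hz.1.1, mem_univ _⟩, hz.1.2⟩
  have hf₂s : ContDiffOn ℝ ∞ f₂ ((Q ×ˢ Set.pi univ fun _ : Fin m₁ => T₁) ×ˢ univ) := by rw [hf₂τ]; exact hG₁s.comp τ.contDiff.contDiffOn hτmaps
  have hf₂C : ∀ (p : P × (Fin m₁ → V₁)) (X : Fin m₂ → M₂), (∃ k, X k ∉ C₂) → f₂ (p, X) = 0 := fun p X hX =>
    hHzero₁ e₁ m₁ (P × (Fin m₂ → M₂)) f₁ (p.1, X) p.2 fun X₁ => hfC₂ p.1 (X₁, X) hX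
  have hf₂bd : ∀ n : ℕ, ∃ B : ℝ, ∀ z ∈ ((S ×ˢ Set.pi univ fun _ : Fin m₁ => T₀₁) ∩ (Q ×ˢ Set.pi univ fun _ : Fin m₁ => T₁)) ×ˢ (univ : Set (Fin m₂ → M₂)),
      ‖iteratedFDeriv ℝ n f₂ z‖ ≤ B := fun n => by
    obtain ⟨B, hB⟩ := hG₁bd n
    refine ⟨‖τ‖ ^ n * max B 0, fun z hz => ?_⟩
    have hzτ : τ z ∈ (Q ×ˢ (univ : Set (Fin m₂ → M₂))) ×ˢ Set.pi univ fun _ : Fin m₁ => T₁ := hτmaps ⟨hz.1.2, mem_univ _⟩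
    rw [hf₂τ]
    refine (norm_iteratedFDeriv_comp_clm_le_of_isOpen τ hO₁ (hG₁s.of_le (mod_cast le_top)) (n := n) hzτ).trans ?_
    refine mul_le_mul_of_nonneg_left ((hB _ ?_).trans (le_max_left _ _)) (pow_nonneg (norm_nonneg _) _)
    rw [hτ]
    exact ⟨⟨⟨hz.1.1.1, mem_univ _⟩, hz.1.2.1, mem_univ _⟩, fun j _ => ⟨hz.1.2.2 j (mem_univ _), hz.1.1.2 j (mem_univ _)⟩⟩
  obtain ⟨hF, hFbd⟩ := contDiffOn_and_forall_bound_nestedBlockReaders Φ₂ hT₂ T₀₂ hunif₂ hread₂ H₂ hH0₂ hHsucc₂ hHzero₂ m₂ e₂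
    (P × (Fin m₁ → V₁)) (Q ×ˢ Set.pi univ fun _ => T₁) hQ₂ f₂ hf₂s C₂ hC₂ hf₂C (S ×ˢ Set.pi univ fun _ => T₀₁) hf₂bd
  refine ⟨hF, fun n => ?_⟩
  obtain ⟨B, hB⟩ := hFbd n
  exact ⟨B, fun z hz => hB z ⟨⟨⟨hz.1.1.1, fun j _ => (hz.1.2 j (mem_univ _)).2⟩, ⟨hz.1.1.2, fun j _ => (hz.1.2 j (mem_univ _)).1⟩⟩, hz.2⟩⟩


end TwoStage

end Literature.Analysis.Calculus

end
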